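import Summits.AtomisticToContinuum.BoseEinsteinCondensation.Theses.BECHardSphereReduction
import Literature.MathematicalPhysics.QuantumManyBody.JelliumBoseGasCondensateDilation

/-!
# Route BECHardSphereReduction — support item `HardSphereScaling`

Exact scale covariance of the hard-sphere family: for `a > 0`,
`condensateNumber HS_a N L = condensateNumber HS_1 N (L/a)`, where
`HS_a = Set.indicator (Set.Iic a) ⊤` is the hard-sphere pair potential of diameter `a`.

This is the neutral-gas dilation covariance
`Literature.MathematicalPhysics.QuantumManyBody.JelliumBoseGas.condensateNumber_dilate`
(`condensateNumber (scalePotential s v) N (sL) = condensateNumber v N L`) at `v := HS_1`, `s := a`,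
box `L/a`, together with the pointwise identity `scalePotential a HS_1 = HS_a`
(`ofReal((a²)⁻¹) · ⊤ = ⊤` since `a ≠ 0`, `· 0 = 0`, and `a⁻¹ r ≤ 1 ↔ r ≤ a`).
-/

namespace Summit.AtomisticToContinuum.BoseEinsteinCondensation.Theorems

open Literature.MathematicalPhysics.QuantumManyBody

/-- The unit hard sphere dilated by `a > 0` is the hard sphere of diameter `a`:
`scalePotential a (⊤·1_{(-∞,1]}) = ⊤·1_{(-∞,a]}` pointwise. -/
theorem scalePotential_hardSphere_one {a : ℝ} (ha : 0 < a) :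
    BoseGas.scalePotential a (Set.indicator (Set.Iic 1) (fun _ : ℝ => (⊤ : ENNReal))) =
      Set.indicator (Set.Iic a) (fun _ : ℝ => (⊤ : ENNReal)) := by
  funext r
  rw [BoseGas.scalePotential_apply]
  have hpos : ENNReal.ofReal (a ^ 2)⁻¹ ≠ 0 :=
    (ENNReal.ofReal_pos.2 (inv_pos.2 (pow_pos ha 2))).ne'
  by_cases hr : r ≤ a
  · have hr' : a⁻¹ * r ≤ 1 := by
      rw [inv_mul_le_iff₀ ha]; simpa using hr
    rw [Set.indicator_of_mem (show a⁻¹ * r ∈ Set.Iic (1 : ℝ) from hr'),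
      Set.indicator_of_mem (show r ∈ Set.Iic a from hr), ENNReal.mul_top hpos]
  · have hr' : ¬ a⁻¹ * r ≤ 1 := by
      rw [inv_mul_le_iff₀ ha]; simpa using hr
    rw [Set.indicator_of_notMem (show a⁻¹ * r ∉ Set.Iic (1 : ℝ) from hr'),
      Set.indicator_of_notMem (show r ∉ Set.Iic a from hr), mul_zero]

/-- **Hard-sphere scale covariance** (route item `HardSphereScaling`, stmt-AtomisticToContinuum-11887):
for every `a > 0`, every box side `L` and particle number `N`,
`condensateNumber HS_a N L = condensateNumber HS_1 N (L/a)`. Proof: the proved dilation covariance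
`JelliumBoseGas.condensateNumber_dilate` with `v := HS_1`, `s := a` at box `L/a`, and
`scalePotential a HS_1 = HS_a` (`scalePotential_hardSphere_one`). No side condition on `L` or `N`
is needed: both sides are defined by the same `⨆ δ ⨅ Ψ` recipe and the dilation is a bijection of
trial states for every `L`. -/
theorem hardSphereScaling_proof :
    Summit.AtomisticToContinuum.BoseEinsteinCondensation.Theses.BECHardSphereReduction.HardSphereScaling := by
  unfold Summit.AtomisticToContinuum.BoseEinsteinCondensation.Theses.BECHardSphereReduction.HardSphereScaling
  intro a L N ha
  have h := JelliumBoseGas.condensateNumber_dilate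
    (Set.indicator (Set.Iic 1) (fun _ : ℝ => (⊤ : ENNReal))) N (L / a) ha
  rw [scalePotential_hardSphere_one ha, mul_div_cancel₀ L ha.ne'] at h
  exact h

end Summit.AtomisticToContinuum.BoseEinsteinCondensation.Theorems
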